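import Literature.MathematicalPhysics.QuantumFieldTheory.Balaban1983to89.B9Thm311PosOfPrincipalAtLettersY
import Literature.MathematicalPhysics.QuantumFieldTheory.Balaban1983to89.B9Thm311FlippedBondForms

/-!
# `Balaban1983to89.B9Eq3132EnergyUpper` — T. Bałaban, *Propagators for lattice gauge theories in a background field*, Commun. Math. Phys. **99** (1985) 389–434
# [Balaban1985BackgroundPropagators], (3.26) p. 395, (3.10) p. 392, (3.69) p. 404: THE UPPER FORM BOUND OF `Δ_a(U)` AT def-Y's LETTERS —
# `⟨A, Δ_a(U)A⟩₁ ≤ Σ_p (1 + |Re U(∂p) − 1|)·HS((D_UA)(p)) + 3c_f²Σ_p |Im U(∂p)|·Σ_{b⊂∂p} HS(A(b)) + ‖D*_UA‖² + ‖Q(U)A‖²_w` (the mirror of n06-j's lower bound)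

statement-level skeleton of published theorems with citation tags; proofs where landed; nothing here is a claim about the Yang–Mills mass gap

THE PRINT.  p. 395 (3.26) *«Δ_a = Δ + DRD\* + Q\*aQ»*; p. 392 (3.10) (the Hessian `Δ(U) = D\*_U𝒦_UD_U + Δ′₂(U)` of the Wilson action); p. 404 (3.69) *«|(Δ′(U′U)A′)(b)| ≤
O(1)(Mα₀ + α₁)(Lʲη)⁻²|A′|»* («Δ′ is a small perturbation of D\*D»); p. 394 (3.20)∕(3.25) (`R(U)` an orthogonal projection).

WHY THIS FILE (dag-n06-i gen 13, N06 bundle F4, row 26).  After `B9Eq3132CoerciveFromEnergy.hco26_of_energy_step12` the row-26 coercivity binders of the N06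
certificate follow from row 17's `hΔA` and ONE energy estimate (P′1): `⟨TΨ, Δ_a(U)TΨ⟩₁ ≤ C‖Ψ‖²` for the transported tent bumps `T = tentOp (bumpProfile)`.
THIS FILE is the operator half of (P′1): the UPPER bound of the form of `Δ_a(U)` by LOCAL quantities — the covariant curl `D_UA` per plaquette with weight
`1 + |Re U(∂p) − 1|`, the commutator part against `c_f²|Im U(∂p)|` on the four edges (n06-j's `abs_trIP_curv2Y_le`, two-sided), the covariant divergence
`‖D\*_UA‖²` (`R(U)` is an orthogonal projection, so `⟨D\*A, R D\*A⟩ ≤ ‖D\*A‖²`: n06-j's `trIP_RY_parSymY_le`), and the averaging term `‖Q(U)A‖²_w` — the exact mirror of n06-j's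
`B9Thm311PosOfPrincipalAtLettersY.trIP_hessY_ge ∕ _of_plaquette_small`.  What (P′1) then owes is: the three kinetic quantities of the transported bumps
(flat bump energies of the tree's `B6QGQCoerciveKLevelV1` + taxicab-ladder holonomy defects under (3.35)) — the sequel.

WHAT IS PROVED (sorry-free, 0 def).
* §1 `re_trace_jordanY_le`, `trIP_jordanY_le` — `⟨F, 𝒦_UF⟩₁ ≤ Σ_p (1 + |Re U(∂p) − 1|)·HS(F(p))`.
* §2 ★ `trIP_hessY_le` (local) and `trIP_hessY_le_of_plaquette_small` (`⟨A, Δ(U)A⟩₁ ≤ (1+δ)⟨D_UA, D_UA⟩₁ + 12(d+1)c_f²δ⟨A, A⟩₁`).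
* §3 ★★ `trIP_deltaAY_parSymY_le` (local) and ★★ `trIP_deltaAY_parSymY_le_of_plaquette_small` (uniform `δ`) — with n06-j's `B9Thm311FlippedBondForms.trIP_RY_parSymY_le`
  (`⟨f, R(U)f⟩₁ ≤ ⟨f, f⟩₁`).

HONEST SCOPE.  Elementary form bounds over def-Y's letters and n06-j's identities; nothing of [B9] asserted; count-neutral; N06 NOT discharged.  Cell `pub-ymgap`
(HUMAN RULING D-0062), Track A node N06 [B9], seat `pub-ymgap-dag-n06-i` (gen 13), 2026-08-27; a NEW file.
-/

noncomputable section

namespace Literature.MathematicalPhysics.QuantumFieldTheory.Balaban1983to89.B9Eq3132EnergyUpper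

open Node00
open B6KLevelCensusIndexV1 (KIdx)
open B9Thm311ReadingCoords (trIP)
open B9Ineq369CurvatureSmallAtLettersY (hs_nonneg abs_re_trace_mul_right_le abs_re_trace_mul_left_le hs_eq_re_trace jordanY_apply_eq_add trIP_one_self_eq
  abs_trIP_curv2Y_le norm_weight_eq)
open B9Thm311PosOfPrincipalAtLettersY (trIP_hessY_eq norm_reHolY_sub_one_le norm_imHolY_le sum_edgeY_le)
open B9Thm311ProjectionR (trIP_deltaAY_parSymY_eq)
open B9Thm311DeltaPrimeSymm (trIP_one_eq)
open B9Thm311FlippedBondForms (trIP_RY_parSymY_le)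
open scoped Matrix Matrix.Norms.L2Operator

variable {d ℓ : ℕ} {hd : 1 ≤ d + 1} {hL : Odd (ℓ + 1) ∧ 1 < ℓ + 1} {b₀ b₁ : ℝ} {N : ℕ}
variable (i : KIdx d ℓ hd hL b₀ b₁) {U : CfgY (Matrix (Fin N) (Fin N) ℂ) i}

/-! ## §1 The Jordan insertion from above -/

/-- per plaquette: `Re tr(F(p)\*·𝒦_U F(p)) ≤ (1 + |Re U(∂p) − 1|)·HS(F(p))`. [cite: Balaban1985BackgroundPropagators, (3.10) p.392, (3.69) p.404] -/
theorem re_trace_jordanY_le (F : PlaqY i → Matrix (Fin N) (Fin N) ℂ) (p : PlaqY i) :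
    (Matrix.trace ((F p)ᴴ * jordanY i U F p)).re ≤ (1 + ‖reHolY i U p - 1‖) * ∑ a, ∑ b, ‖F p a b‖ ^ 2 := by
  set E := reHolY i U p - 1 with hE
  have hexp : (Matrix.trace ((F p)ᴴ * jordanY i U F p)).re = ∑ a, ∑ b, ‖F p a b‖ ^ 2 +
      (1 / 2 : ℝ) * ((Matrix.trace ((F p)ᴴ * (F p * E))).re + (Matrix.trace ((F p)ᴴ * (E * F p))).re) := by
    rw [jordanY_apply_eq_add, ← hE, Matrix.mul_add, Matrix.mul_smul, Matrix.mul_add, Matrix.trace_add, Matrix.trace_smul, Matrix.trace_add,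
      Complex.add_re, smul_eq_mul, Complex.re_ofReal_mul, Complex.add_re, hs_eq_re_trace]
  have h1 := abs_re_trace_mul_right_le (F p) E
  have h2 := abs_re_trace_mul_left_le (F p) E
  rw [abs_le] at h1 h2
  rw [hexp]
  nlinarith [h1.2, h2.2]

/-- summed: `⟨F, 𝒦_UF⟩₁ ≤ Σ_p (1 + |Re U(∂p) − 1|)·HS(F(p))`. [cite: Balaban1985BackgroundPropagators, (3.10) p.392, (3.69) p.404] -/
theorem trIP_jordanY_le (F : PlaqY i → Matrix (Fin N) (Fin N) ℂ) :
    trIP (fun _ => (1 : ℝ)) F (jordanY i U F) ≤ ∑ p, (1 + ‖reHolY i U p - 1‖) * ∑ a, ∑ b, ‖F p a b‖ ^ 2 := by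
  rw [trIP_one_eq, Complex.re_sum]
  exact Finset.sum_le_sum fun p _ => re_trace_jordanY_le i F p

/-! ## §2 The Hessian `Δ(U)` from above -/

/-- ★ **THE HESSIAN FROM ABOVE, local form**: at every unitary-valued background
`⟨A, Δ(U)A⟩₁ ≤ Σ_p (1 + |Re U(∂p) − 1|)·HS((D_UA)(p)) + 3·c_f²·Σ_p |Im U(∂p)|·Σ_{m<4} HS(A(b_m(p)))`. [cite: Balaban1985BackgroundPropagators, (3.10) p.392, (3.69) p.404] -/
theorem trIP_hessY_le (hU : ∀ μ x, ((U μ x : (Matrix (Fin N) (Fin N) ℂ)ˣ) : Matrix (Fin N) (Fin N) ℂ) ∈ unitary (Matrix (Fin N) (Fin N) ℂ))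
    (A : FBondY i → Matrix (Fin N) (Fin N) ℂ) :
    trIP (fun _ => (1 : ℝ)) A (hessY i U A) ≤
      ∑ p : PlaqY i, (1 + ‖reHolY i U p - 1‖) * ∑ a, ∑ b, ‖curlY i U A p a b‖ ^ 2
        + 3 * ∑ p : PlaqY i, i.cf ^ 2 * ‖imHolY i U p‖ * ∑ m : Fin 4, ∑ a, ∑ b, ‖A (edgeY i p m) a b‖ ^ 2 := by
  rw [trIP_hessY_eq i hU A]
  have h1 := trIP_jordanY_le i (U := U) (curlY i U A)
  have h2 := abs_trIP_curv2Y_le i U hU A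
  simp_rw [norm_weight_eq] at h2
  rw [abs_le] at h2
  linarith [h2.2]

/-- ★ **THE HESSIAN FROM ABOVE, uniform form**: if every plaquette holonomy is `δ`-close to `1` then
`⟨A, Δ(U)A⟩₁ ≤ (1 + δ)·⟨D_UA, D_UA⟩₁ + 12(d+1)·c_f²·δ·⟨A, A⟩₁`. [cite: Balaban1985BackgroundPropagators, (3.69) p.404, (3.10) p.392] -/
theorem trIP_hessY_le_of_plaquette_small
    (hU : ∀ μ x, ((U μ x : (Matrix (Fin N) (Fin N) ℂ)ˣ) : Matrix (Fin N) (Fin N) ℂ) ∈ unitary (Matrix (Fin N) (Fin N) ℂ)) {δ : ℝ} (hδ0 : 0 ≤ δ)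
    (hδ : ∀ p : PlaqY i, ‖((holY i U p : (Matrix (Fin N) (Fin N) ℂ)ˣ) : Matrix (Fin N) (Fin N) ℂ) - 1‖ ≤ δ)
    (A : FBondY i → Matrix (Fin N) (Fin N) ℂ) :
    trIP (fun _ => (1 : ℝ)) A (hessY i U A) ≤
      (1 + δ) * trIP (fun _ => (1 : ℝ)) (curlY i U A) (curlY i U A) + 12 * (d + 1) * i.cf ^ 2 * δ * trIP (fun _ => (1 : ℝ)) A A := by
  have h0 := trIP_hessY_le i hU A
  have hJ : ∑ p : PlaqY i, (1 + ‖reHolY i U p - 1‖) * ∑ a, ∑ b, ‖curlY i U A p a b‖ ^ 2 ≤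
      (1 + δ) * trIP (fun _ => (1 : ℝ)) (curlY i U A) (curlY i U A) := by
    rw [trIP_one_self_eq, Finset.mul_sum]
    exact Finset.sum_le_sum fun p _ => mul_le_mul_of_nonneg_right (by linarith [norm_reHolY_sub_one_le i U hU (hδ p)]) (hs_nonneg _)
  have hC : ∑ p : PlaqY i, i.cf ^ 2 * ‖imHolY i U p‖ * ∑ m : Fin 4, ∑ a, ∑ b, ‖A (edgeY i p m) a b‖ ^ 2 ≤
      ∑ p : PlaqY i, (i.cf ^ 2 * δ) * ∑ m : Fin 4, ∑ a, ∑ b, ‖A (edgeY i p m) a b‖ ^ 2 :=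
    Finset.sum_le_sum fun p _ => mul_le_mul_of_nonneg_right (mul_le_mul_of_nonneg_left (norm_imHolY_le i U hU (hδ p)) (sq_nonneg _))
      (Finset.sum_nonneg fun _ _ => hs_nonneg _)
  rw [← Finset.mul_sum] at hC
  have hE := sum_edgeY_le i (g := fun b => ∑ a, ∑ b', ‖A b a b'‖ ^ 2) fun _ => hs_nonneg _
  rw [← trIP_one_self_eq] at hE
  have hE' := mul_le_mul_of_nonneg_left hE (by positivity : (0 : ℝ) ≤ i.cf ^ 2 * δ)
  linarith [h0, hJ, hC, hE']

/-! ## §3 `Δ_a(U)` from above (`⟨f, R(U)f⟩₁ ≤ ⟨f, f⟩₁` is n06-j's `B9Thm311FlippedBondForms.trIP_RY_parSymY_le`) -/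

/-- ★★ **`Δ_a(U)` FROM ABOVE, local form**: at a `G`-valued background (`G ≤ U(N)`)
`⟨A, Δ_a(U)A⟩₁ ≤ Σ_p (1 + |Re U(∂p) − 1|)·HS((D_UA)(p)) + 3c_f²Σ_p |Im U(∂p)|·Σ_m HS(A(b_m(p))) + ⟨D\*_UA, D\*_UA⟩₁ + ⟨Q(U)A, Q(U)A⟩_w`.
[cite: Balaban1985BackgroundPropagators, (3.26) p.395, (3.10) p.392, (3.69) p.404, (3.20) p.394] -/
theorem trIP_deltaAY_parSymY_le {G : Subgroup (Matrix (Fin N) (Fin N) ℂ)ˣ} (hG : G ≤ B7Prop2Explicit.unitaryUnits (Matrix (Fin N) (Fin N) ℂ))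
    (hU : ∀ μ x, U μ x ∈ G) (A : FBondY i → Matrix (Fin N) (Fin N) ℂ) :
    trIP (fun _ => (1 : ℝ)) A (deltaAY i (parSymY i) (parBY i) (GpY i (parSymY i)) U A) ≤
      (∑ p : PlaqY i, (1 + ‖reHolY i U p - 1‖) * ∑ a, ∑ b, ‖curlY i U A p a b‖ ^ 2
        + 3 * ∑ p : PlaqY i, i.cf ^ 2 * ‖imHolY i U p‖ * ∑ m : Fin 4, ∑ a, ∑ b, ‖A (edgeY i p m) a b‖ ^ 2)
      + trIP (fun _ => (1 : ℝ)) (divY i U A) (divY i U A) + trIP i.w (QY i (parBY i) U A) (QY i (parBY i) U A) := by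
  have hU' : ∀ μ x, ((U μ x : (Matrix (Fin N) (Fin N) ℂ)ˣ) : Matrix (Fin N) (Fin N) ℂ) ∈ unitary (Matrix (Fin N) (Fin N) ℂ) := fun μ x => hG (hU μ x)
  rw [trIP_deltaAY_parSymY_eq i hG hU A]
  have h1 := trIP_hessY_le i hU' A
  have h2 := trIP_RY_parSymY_le i hG hU (divY i U A)
  linarith

/-- ★★ **`Δ_a(U)` FROM ABOVE, uniform form**: `G ≤ U(N)`, `U` `G`-valued, `0 ≤ δ`, all `|U(∂p) − 1| ≤ δ` ⇒
`⟨A, Δ_a(U)A⟩₁ ≤ (1 + δ)⟨D_UA, D_UA⟩₁ + 12(d+1)c_f²δ⟨A, A⟩₁ + ⟨D\*_UA, D\*_UA⟩₁ + ⟨Q(U)A, Q(U)A⟩_w` — so the energy bound (P′1) of a test family is reduced to its three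
kinetic quantities `‖D_U(TΨ)‖²`, `‖D\*_U(TΨ)‖²`, `‖Q(U)(TΨ)‖²_w` and the size `c_f²δ·‖TΨ‖²`. [cite: Balaban1985BackgroundPropagators, (3.26) p.395, (3.69) p.404, Thm 3.11 p.416] -/
theorem trIP_deltaAY_parSymY_le_of_plaquette_small {G : Subgroup (Matrix (Fin N) (Fin N) ℂ)ˣ}
    (hG : G ≤ B7Prop2Explicit.unitaryUnits (Matrix (Fin N) (Fin N) ℂ)) (hU : ∀ μ x, U μ x ∈ G) {δ : ℝ} (hδ0 : 0 ≤ δ)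
    (hδ : ∀ p : PlaqY i, ‖((holY i U p : (Matrix (Fin N) (Fin N) ℂ)ˣ) : Matrix (Fin N) (Fin N) ℂ) - 1‖ ≤ δ)
    (A : FBondY i → Matrix (Fin N) (Fin N) ℂ) :
    trIP (fun _ => (1 : ℝ)) A (deltaAY i (parSymY i) (parBY i) (GpY i (parSymY i)) U A) ≤
      (1 + δ) * trIP (fun _ => (1 : ℝ)) (curlY i U A) (curlY i U A) + 12 * (d + 1) * i.cf ^ 2 * δ * trIP (fun _ => (1 : ℝ)) A A
      + trIP (fun _ => (1 : ℝ)) (divY i U A) (divY i U A) + trIP i.w (QY i (parBY i) U A) (QY i (parBY i) U A) := by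
  have hU' : ∀ μ x, ((U μ x : (Matrix (Fin N) (Fin N) ℂ)ˣ) : Matrix (Fin N) (Fin N) ℂ) ∈ unitary (Matrix (Fin N) (Fin N) ℂ) := fun μ x => hG (hU μ x)
  rw [trIP_deltaAY_parSymY_eq i hG hU A]
  have h1 := trIP_hessY_le_of_plaquette_small i hU' hδ0 hδ A
  have h2 := trIP_RY_parSymY_le i hG hU (divY i U A)
  linarith

end Literature.MathematicalPhysics.QuantumFieldTheory.Balaban1983to89.B9Eq3132EnergyUpper

end
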